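import Literature.NumberTheory.Automorphic.RamakrishnanMultiplicityOneSL2Leaves
import HarnessLib

/-!
# Ramakrishnan 2000, Theorem 4.1.2 (multiplicity one for `SL(2)`, `GL(2)` form), assembled from its leaves

Topic `NumberTheory/Automorphic`; namespace `Literature.NumberTheory.Automorphic`. A one-theorem
bookkeeping file (fact decomposition, librarian 2026-08-16) for the named fact
`Literature.NumberTheory.Automorphic.Ramakrishnan2000_multiplicityOneSL2`
(`RamakrishnanTensorProductGL2.lean`; D. Ramakrishnan, *Modularity of the Rankin–Selberg `L`-series,
and multiplicity one for `SL(2)`*, Ann. of Math. (2) 152 (2000), 45–111, **Thm. 4.1.2**: cuspidal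
`π, π'` on `GL(2)/F` with `Ad(π_v) ≃ Ad(π'_v)` a.e. differ by an idele class character).

The printed proof (§4.1, pp. 37–39) has been formalised in the tree modulo named facts
(`RamakrishnanTensorProductGL2Proofs`, `…MultiplicityOneLemma414`, `…MultiplicityOneDihedral`,
`…MultiplicityOneSL2Reductions`, `…MultiplicityOneSL2Leaves`). Its final form
`Ramakrishnan2000_multiplicityOneSL2.of_L2_leaves` (`RamakrishnanMultiplicityOneSL2Leaves.lean`)
derives the fact from the following existing named facts of the tree, everything else on the
printed path (Jacquet–Shalika (2.1), the Borel–Jacquet dictionary and unitary normalisation,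
central characters, class field theory for quadratic characters, Hilbert 90, uniqueness of Satake
parameters) being theorems:

1. `Ramakrishnan2000_boxTimes_cuspidal` — Theorem M, cuspidal case (Existence of `π ⊠ π'` on
   `GL(4)` and the "if" half of the cuspidality criterion; op. cit. §3) — the source of `χ` in the
   non-dihedral case (p. 39);
2. `GelbartJacquet_adjoint_lift` — Gelbart–Jacquet (1978), (9.3): `Ad(π)` cuspidal on `GL(3)` for
   non-dihedral `π` (Lemma 4.1.4);
3. `ArthurClozel1989_inducedLift_of_twist_eq 2 F E` — Arthur–Clozel, Ch. 3, Thm. 4.2 (b): a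
   cuspidal `P` on `GL(2)/F` with `P ⊗ η_{E/F} = P` is induced from `E` (the both-dihedral case,
   p. 38);
4. `multiplicity_one_gl` — multiplicity one on `L²_cusp(GL_n)` (Shalika 1974);
5.–8. Jacquet–Shalika (2.2)–(2.3) in `L²_cusp` (Arthur–Clozel, Ch. 3, (2.2)–(2.3)):
   `JacquetShalika1981_partialPairL_at_one_of_ne_conj`, `…_boundary_of_ne_one`,
   `…_at_one_of_rank_ne`, `…_pole_of_eq_conj`;
9. `heckeLFunction_hasEntireContinuation_of_not_isNormTwist` — Tate's thesis (Cassels–Fröhlich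
   Ch. XV, Thm. 4.4.1): the dichotomy lemma of the dihedral case.

This file records that edge under the decomposition name
`Ramakrishnan2000_multiplicityOneSL2_holds_of`, whose hypotheses are exactly these nine children
(parametrised facts enter through their universal closures, as in `…of_L2_leaves`). No
definition, no new named fact, nothing restated. (The variant over the Mœglin–Waldspurger
continuation facts is `Ramakrishnan2000_multiplicityOneSL2.of_MW_leaves`, ibid.)

## References

* D. Ramakrishnan, Ann. of Math. (2) 152 (2000), 45–111, §4.1, Thm. 4.1.2 and its proof
  (pp. 37–39), Lemma 4.1.4; Theorem M (§3). [Ramakrishnan2000]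
* J. Arthur, L. Clozel, *Simple algebras, base change, and the advanced theory of the trace
  formula*, Ann. of Math. Stud. 120 (1989), Ch. 3 §2 (2.1)–(2.3), Thm. 4.2 (b). [ArthurClozelAMS120]
* J. Tate, in Cassels–Fröhlich, *Algebraic Number Theory* (1967), Ch. XV, Thm. 4.4.1. [TateThesis1967]
-/

noncomputable section

open scoped Topology NNReal
open NumberField IsDedekindDomain MeasureTheory Filter Complex Set
open Literature.NumberTheory.GaloisRepresentations

namespace Literature.NumberTheory.Automorphic

open AdelicGroupData

/-- **`Ramakrishnan2000_multiplicityOneSL2` from its nine children** (Ramakrishnan 2000,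
Thm. 4.1.2, printed proof §4.1 pp. 37–39): Theorem M in its cuspidal case
(`Ramakrishnan2000_boxTimes_cuspidal`), Gelbart–Jacquet (`GelbartJacquet_adjoint_lift`),
Arthur–Clozel Thm. 4.2 (b) on `GL(2)` (`ArthurClozel1989_inducedLift_of_twist_eq 2`), multiplicity
one on `L²_cusp` (`multiplicity_one_gl`), the four `L²` forms of Jacquet–Shalika (2.2)–(2.3)
(`JacquetShalika1981_partialPairL_at_one_of_ne_conj`, `…_boundary_of_ne_one`,
`…_at_one_of_rank_ne`, `…_pole_of_eq_conj`) and Tate's continuation of Hecke `L`-functions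
(`heckeLFunction_hasEntireContinuation_of_not_isNormTwist`) imply the fact — the tree's
`Ramakrishnan2000_multiplicityOneSL2.of_L2_leaves`.
[cite: Ramakrishnan2000, Theorem 4.1.2 and §4.1 (proof), Lemma 4.1.4] -/
theorem Ramakrishnan2000_multiplicityOneSL2_holds_of
    (hB : Ramakrishnan2000_boxTimes_cuspidal)
    (hGJ : GelbartJacquet_adjoint_lift)
    (hAC : ∀ (F E : Type) [Field F] [NumberField F] [Field E] [NumberField E] [Algebra F E]
      [FiniteDimensional F E], ArthurClozel1989_inducedLift_of_twist_eq 2 F E)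
    (hm1 : ∀ (n : ℕ) (K : Type) [Field K] [NumberField K] (μ : Measure (gl n K).automorphicQuotient)
      [(gl n K).IsAutomorphicMeasure μ], multiplicity_one_gl n K μ)
    (h22 : ∀ {n : ℕ} {K : Type} [Field K] [NumberField K] {μ : Measure (gl n K).automorphicQuotient}
      [(gl n K).IsAutomorphicMeasure μ],
      JacquetShalika1981_partialPairL_at_one_of_ne_conj (n := n) (K := K) (μ := μ))
    (h22' : ∀ {n m : ℕ} {K : Type} [Field K] [NumberField K]
      {μ : Measure (gl n K).automorphicQuotient} [(gl n K).IsAutomorphicMeasure μ]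
      {μ' : Measure (gl m K).automorphicQuotient} [(gl m K).IsAutomorphicMeasure μ'],
      JacquetShalika1981_partialPairL_boundary_of_ne_one (n := n) (m := m) (K := K) (μ := μ)
        (μ' := μ'))
    (hrk : ∀ {n m : ℕ} {K : Type} [Field K] [NumberField K]
      {μ : Measure (gl n K).automorphicQuotient} [(gl n K).IsAutomorphicMeasure μ]
      {μ' : Measure (gl m K).automorphicQuotient} [(gl m K).IsAutomorphicMeasure μ'],
      JacquetShalika1981_partialPairL_at_one_of_rank_ne (n := n) (m := m) (K := K) (μ := μ)
        (μ' := μ'))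
    (h23 : ∀ {n : ℕ} {K : Type} [Field K] [NumberField K] {μ : Measure (gl n K).automorphicQuotient}
      [(gl n K).IsAutomorphicMeasure μ],
      JacquetShalika1981_partialPairL_pole_of_eq_conj (n := n) (K := K) (μ := μ))
    (hT : ∀ (E : Type) [Field E] [NumberField E] (χ : HeckeCharacter E),
      heckeLFunction_hasEntireContinuation_of_not_isNormTwist χ) :
    Ramakrishnan2000_multiplicityOneSL2 :=
  Ramakrishnan2000_multiplicityOneSL2.of_L2_leaves hB hGJ hAC hm1 h22 h22' hrk h23 hT

end Literature.NumberTheory.Automorphic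

end
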